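import Literature.Barriers.CriticalPhenomena.RigorousRGSmallParameterPerturbativeCoefficientsXi
import Literature.Barriers.CriticalPhenomena.RigorousRGSmallParameterCovarianceMassDerivativeBound
import HarnessLib

/-!
# `RigorousRGSmallParameter` (Slade, Theorem 1.4.1): Lemma 5.2.1, (5.23) — the mass derivative
# `|∂β_j/∂m²| ≲ L^{αj}(m²L^{αj})^{-r}` below the mass scale, for the explicit decomposition

Companion of `RigorousRGSmallParameterPerturbativeCoefficients.lean` (the coefficients of §5.1–§5.2
and (5.22)) and of `RigorousRGSmallParameterCovarianceMassDerivativeBound.lean` (the `∂/∂m²`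
display of Proposition 3.3.1). Source: G. Slade, *Critical exponents for long-range `O(n)` models
below the upper critical dimension*, Commun. Math. Phys. **358** (2018) 343–436, arXiv:1611.06169,
Lemma 5.2.1: "Moreover, with `c_{∂β}` dependent on `L`, and assuming `m² ∈ (0,m̄²]`, and `j ≤ j_m`,
(5.23) `|∂β_j/∂m²| ≤ c_{∂β} L^{αj} (1+𝟙_{d=2}|log(m²L^{αj})|)/(m²L^{αj})^r` with `r = 2-1/α`
(`d = 1`), `2-2/α` (`d = 2,3`)", and its proof in §10.2: "For (5.23), we restrict to
`m²L^{αj} ∈ (0,1]`. Let `r_1 = 2-1/α` and `r_2 = r_3 = 2-2/α`. We differentiate the middle member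
of (10.28) using the product rule, and apply (3.x-new) and `M_j ≤ 1`. For `d = 1,3`, this gives
`|∂β_j/∂m²| ≲ (m²L^{αj})^{-r}Σ_{k=0}^jL^{dk}L^{-(d-α)k} + L^{-εj}L^{-(d-α)j}Σ_{k=0}^jL^{dk}L^{εk}
(m²L^{αk})^{-r} ≲ L^{αj}(m²L^{αj})^{-r}`, as stated in (5.23). For `d = 2`, there is an additional
logarithmic factor due to the logarithmic factor in (3.x-new)." This is the input of Lemma 5.2.4
("integration of this modification of (5.23) gives (note that `1-r > 0`) `|β_j(m²) - β_j(0)| ≤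
(1/(1-r))c_{∂β}(m²L^{αj})^{1-r}`").

## What this file proves (everything; no definition and no named fact is introduced)

* `PT.deriv_fracCov_eq_zero_of_not_mem_ball`, `PT.hasDerivAt_wCov_mass` — bookkeeping for the
  product rule.
* **`PT.abs_deriv_betaCoeff_le_of`** — (5.23) with the `∂/∂m²` display as an abstract input
  (exponent `r < 2`, constant `c_D`): for fixed `L ≥ 2`, `|∂β_j/∂m²| ≤ cL^{αj}(m²L^{αj})^{-r}` for
  `m² > 0`, `m²L^{αj} ≤ 1`, all `j ≥ 0`, with differentiability of `m² ↦ β_j(m²)` (near such `m²`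
  the rescaling `L^{-ε(j∧j_m)}` is the constant `L^{-εj}`).
* **`PT.Slade2017_lem521_massDeriv_d1`** (`α ∈ (½,1)`, `r = 2-1/α`),
  **`PT.Slade2017_lem521_massDeriv_dge3`** (`d ≥ 3`, `α ∈ (1,2)`, `r = 2-2/α`),
  **`PT.Slade2017_lem521_massDeriv_d2`** (`α ∈ (1,2)`, `r = 2-2/α+2θ/α` for any `θ ∈ (0,1)`) —
  (5.23) PROVED for the explicit decomposition, fed by `FRD.Slade2017_prop331_massDeriv_d1/_d2/_dge3`.

Scope / reading. (i) Range: `m² > 0` with `m²L^{αj} ≤ 1` (the range of the printed proof; the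
printed statement's `m² ∈ (0,m̄²]`, `j ≤ j_m` allows `m²L^{αj}` up to `m̄²L^α`, where the bound is
not what the proof delivers). (ii) `d = 2`: the logarithm is replaced by the power `(m²L^{αj})^{-2θ/α}`,
`θ > 0` arbitrary — the form in which the paper uses (5.23) (proof of Lemma 5.2.4). (iii) Constants
depend on `L` (as printed) and on `d, n, α` (and `θ`).
-/

noncomputable section

namespace Literature.Barriers.CriticalPhenomena

open _root_.MeasureTheory Set Filter
open scoped _root_.Topology Real

namespace LongRangePhi4

namespace PT

open Literature.Probability.LatticeModels FRD

variable {d : ℕ}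

/-! ### Lemma 5.2.1, (5.23): the mass derivative of `β_j` below the mass scale -/

/-- Off the range, the mass derivative of `C_{k;0,x}` vanishes: for `x ∉ {|x|₁ < ½L^i}`, `k ≤ i`,
`∂C_{k;0,x}/∂m² = 0` (the function `m² ↦ C_{k;0,x}(m²)` is identically zero).
[cite: Slade2017, Proposition 3.3.1 (finite range)] -/
theorem deriv_fracCov_eq_zero_of_not_mem_ball (hd : 1 ≤ d) {L : ℝ} (hL : 1 ≤ L) (α : ℝ) {k i : ℕ}
    (hki : k ≤ i) {x : Site d} (hx : x ∉ ball (L ^ i / 2)) (m2 : ℝ) :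
    deriv (fun a : ℝ => fracCov d L α a k x) m2 = 0 := by
  have : (fun a : ℝ => fracCov d L α a k x) = fun _ => 0 :=
    funext fun a => fracCov_eq_zero_of_not_mem_ball hd hL α a hki hx
  rw [this, deriv_const]

/-- `m² ↦ w_{i;0,x}(m²)` is differentiable at `m² > 0`, with derivative `Σ_{k=1}^i ∂C_{k;0,x}/∂m²`.
[cite: Slade2017, §10.2 (proof of (5.23): "We differentiate … using the product rule")] -/
theorem hasDerivAt_wCov_mass (hd : 1 ≤ d) {α : ℝ} (hα0 : 0 < α) (hα2 : α < 2) {L : ℝ} (hL : 2 ≤ L)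
    {m2 : ℝ} (hm2 : 0 < m2) (i : ℕ) (x : Site d) :
    HasDerivAt (fun a : ℝ => wCov d L α a i x)
      (∑ k ∈ Finset.Icc 1 i, deriv (fun a : ℝ => fracCov d L α a k x) m2) m2 := by
  unfold wCov
  refine HasDerivAt.fun_sum fun k hk => ?_
  exact (hasDerivAt_fracCov_mass hd hα0 hα2 hL hm2 (Finset.mem_Icc.1 hk).1 x).2.differentiableAt.hasDerivAt

/-- **Lemma 5.2.1, (5.23), with the `∂/∂m²` display of Proposition 3.3.1 as input** (its
exponent `r ∈ [0,2)` and constant `c_D` abstract): for fixed `L ≥ 2` there is `c` (depending on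
`L, d, n, α, r, c_D`) such that for `m² > 0` and `m²L^{αj} ≤ 1` the map `m² ↦ β_j(m²)` is
differentiable and `|∂β_j/∂m²| ≤ c L^{αj} (m²L^{αj})^{-r}`. Printed proof: "we restrict to
`m²L^{αj} ∈ (0,1]` … We differentiate the middle member of (10.28) using the product rule, and
apply (3.x-new) and `M_j ≤ 1`. For `d = 1,3`, this gives `|∂β_j/∂m²| ≲ (m²L^{αj})^{-r}Σ_{k=0}^j
L^{dk}L^{-(d-α)k} + L^{-εj}L^{-(d-α)j}Σ_{k=0}^jL^{dk}L^{εk}(m²L^{αk})^{-r} ≲ L^{αj}(m²L^{αj})^{-r}`,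
as stated in (5.23). For `d = 2`, there is an additional logarithmic factor". Here: `∂β'_j =
(n+8)Σ_x[∂C_{j+1}(w_j+w_{j+1}) + C_{j+1}∂(w_j+w_{j+1})]`; the first term is bounded by
`sup|∂C_{j+1}|(‖w_j‖₁+‖w_{j+1}‖₁)`, the second by `sup|C_{j+1}|·2Σ_{k≤j+1}‖∂C_k‖₁` with
`‖∂C_k‖₁ ≤ 2^dL^dc_D m^{-2r}(L^{α(2-r)})^{k-1}` (range times the display, using
`m²L^{α(k-1)} ≤ m²L^{αj} ≤ 1`), a geometric sum with ratio `L^{α(2-r)} > 1`; both are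
`≲ (L^j)^{3α-d}(m²L^{αj})^{-r}`, and `β_j = L^{-εj}β'_j` near such `m²` (there `j + 1 ≤ j_m`).
[cite: Slade2017, Lemma 5.2.1 (display (5.23))] [cite: Slade2017, §10.2 (proof of (5.23))] -/
theorem abs_deriv_betaCoeff_le_of (hd : 1 ≤ d) (n : ℕ) {α : ℝ} (hα0 : 0 < α) (hα2 : α < 2)
    (hαd : α < d) {cD r : ℝ} (hcD : 0 < cD) (hr2 : r < 2)
    (hD : ∀ L : ℝ, 2 ≤ L → ∀ m2 : ℝ, 0 < m2 → ∀ j : ℕ, 1 ≤ j → ∀ x : Site d,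
      m2 * (L ^ (j - 1)) ^ α ≤ 1 →
      |deriv (fun a : ℝ => fracCov d L α a j x) m2| ≤
        cD * (L ^ (j - 1)) ^ (2 * α - d) * (m2 * (L ^ (j - 1)) ^ α) ^ (-r))
    {L : ℝ} (hL : 2 ≤ L) :
    ∃ c : ℝ, 0 < c ∧ ∀ m2 : ℝ, 0 < m2 → ∀ j : ℕ, m2 * (L ^ j) ^ α ≤ 1 →
      HasDerivAt (fun a : ℝ => betaCoeff d n L α a j) (deriv (fun a : ℝ => betaCoeff d n L α a j) m2) m2 ∧
      |deriv (fun a : ℝ => betaCoeff d n L α a j) m2| ≤ c * (L ^ α) ^ j * (m2 * (L ^ j) ^ α) ^ (-r) := by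
  classical
  have hL0 : (0 : ℝ) < L := by linarith
  have hL1 : (1 : ℝ) ≤ L := by linarith
  have hL1' : (1 : ℝ) < L := by linarith
  obtain ⟨c₀, hc₀, hC⟩ := abs_fracCov_le_massFactor hd hα0 hα2 hαd (mbar := 1) zero_le_one
  obtain ⟨c₁, hc₁, hW⟩ := sum_abs_wCov_le hd hα0 hα2 hαd (mbar := 1) zero_le_one
  -- the geometric ratio `ρ = L^{α(2-r)} > 1`
  set ρ : ℝ := L ^ (α * (2 - r)) with hρ
  have hρ1 : 1 < ρ := Real.one_lt_rpow hL1' (by nlinarith)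
  have hρ0 : 0 < ρ := by linarith
  set Kρ : ℝ := ρ / (ρ - 1) with hKρ
  have hKρ0 : 0 < Kρ := div_pos hρ0 (by linarith)
  -- the constant
  set c : ℝ := (n + 8) * (2 * c₁ * cD * (L ^ d * L ^ α) + 2 * (c₀ * (2 ^ d * L ^ d * cD * Kρ))) with hc
  refine ⟨c, by positivity, fun m2 hm2 j hAj => ?_⟩
  -- notation
  set ℓ : ℝ := L ^ j with hℓ
  have hℓ0 : 0 < ℓ := by positivity
  have hℓ1 : 1 ≤ ℓ := one_le_pow₀ hL1
  set Aj : ℝ := m2 * ℓ ^ α with hAjdef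
  have hAj0 : 0 < Aj := by positivity
  have hm21 : m2 ≤ 1 := by
    have : 1 ≤ ℓ ^ α := Real.one_le_rpow hℓ1 hα0.le
    nlinarith
  set S : Finset (Site d) := ball (L ^ (j + 1) / 2) with hS
  -- derivatives of the `C_k` and of the `w_i`
  set DC : ℕ → Site d → ℝ := fun k x => deriv (fun a : ℝ => fracCov d L α a k x) m2 with hDC
  set DW : ℕ → Site d → ℝ := fun i x => ∑ k ∈ Finset.Icc 1 i, DC k x with hDW
  have hW' : ∀ i x, HasDerivAt (fun a : ℝ => wCov d L α a i x) (DW i x) m2 :=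
    fun i x => hasDerivAt_wCov_mass hd hα0 hα2 hL hm2 i x
  -- the uniform bounds: `|C_{j+1}|`, `|∂C_k|` for `k ≤ j+1`
  have hAk : ∀ k, 1 ≤ k → k ≤ j + 1 → m2 * (L ^ (k - 1)) ^ α ≤ 1 := by
    intro k hk hkj
    refine le_trans ?_ hAj
    have : (L ^ (k - 1) : ℝ) ^ α ≤ (L ^ j) ^ α :=
      Real.rpow_le_rpow (by positivity) (pow_le_pow_right₀ hL1 (by omega)) hα0.le
    exact mul_le_mul_of_nonneg_left this hm2.le
  have hsupC : ∀ x, |fracCov d L α m2 (j + 1) x| ≤ c₀ * ℓ ^ (α - (d : ℝ)) := by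
    intro x
    have h := hC L hL m2 hm2.le hm21 (j + 1) (by omega) x
    rw [Nat.add_sub_cancel] at h
    refine h.trans ?_
    have hM := massFactor_le_one hL0 α hm2.le (j + 1)
    have : 0 ≤ c₀ * ℓ ^ (α - (d : ℝ)) := by positivity
    calc c₀ * (L ^ j) ^ (α - (d : ℝ)) * massFactor L α m2 (j + 1) ≤ c₀ * ℓ ^ (α - (d : ℝ)) * 1 := by
          rw [← hℓ]; gcongr
      _ = c₀ * ℓ ^ (α - (d : ℝ)) := mul_one _
  have hsupD : ∀ k, 1 ≤ k → k ≤ j + 1 → ∀ x,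
      |DC k x| ≤ cD * (L ^ (k - 1)) ^ (2 * α - d) * (m2 * (L ^ (k - 1)) ^ α) ^ (-r) :=
    fun k hk hkj x => hD L hL m2 hm2 k hk x (hAk k hk hkj)
  have hD0 : ∀ k, 1 ≤ k → k ≤ j + 1 → ∀ x, x ∉ ball (L ^ (j + 1) / 2) → DC k x = 0 :=
    fun k _ hkj x hx => deriv_fracCov_eq_zero_of_not_mem_ball hd hL1 α hkj hx m2
  -- `‖∂C_k‖₁ ≤ 2^d L^d c_D m^{-2r} ρ^{k-1}`
  have hl1D : ∀ k, 1 ≤ k → k ≤ j + 1 →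
      ∑ x ∈ S, |DC k x| ≤ 2 ^ d * L ^ d * cD * m2 ^ (-r) * ρ ^ (k - 1) := by
    intro k hk hkj
    have hℓk0 : (0 : ℝ) < L ^ (k - 1) := by positivity
    -- restrict to the range of `C_k`
    have hrestr : ∑ x ∈ S, |DC k x| = ∑ x ∈ S ∩ ball (L ^ k / 2), |DC k x| := by
      rw [← Finset.sum_sdiff (Finset.inter_subset_left (s₁ := S) (s₂ := ball (L ^ k / 2)))]
      rw [Finset.sum_eq_zero (s := S \ (S ∩ ball (L ^ k / 2))) fun x hx => by
        rw [Finset.mem_sdiff, Finset.mem_inter, not_and] at hx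
        rw [show DC k x = 0 from deriv_fracCov_eq_zero_of_not_mem_ball hd hL1 α le_rfl (hx.2 hx.1) m2,
          abs_zero], zero_add]
    have hcard : (((S ∩ ball (L ^ k / 2)).card : ℕ) : ℝ) ≤ 2 ^ d * L ^ d * (L ^ (k - 1)) ^ d := by
      calc (((S ∩ ball (L ^ k / 2)).card : ℕ) : ℝ) ≤ (ball (d := d) (L ^ k / 2)).card := by
            exact_mod_cast Finset.card_le_card Finset.inter_subset_right
        _ ≤ (2 * (L ^ k / 2) + 1) ^ d := card_ball_le (by positivity)
        _ = (L ^ k + 1) ^ d := by ring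
        _ ≤ (2 * L ^ k) ^ d := by
            apply pow_le_pow_left₀ (by positivity)
            have : (1 : ℝ) ≤ L ^ k := one_le_pow₀ hL1
            linarith
        _ = 2 ^ d * L ^ d * (L ^ (k - 1)) ^ d := by
            rw [mul_pow, ← pow_mul, ← pow_mul, mul_assoc, ← pow_add]
            congr 2
            calc k * d = (1 + (k - 1)) * d := by rw [Nat.add_sub_cancel' hk]
              _ = d + (k - 1) * d := by ring
    -- the power identity `(L^{k-1})^d (L^{k-1})^{2α-d} (m2 (L^{k-1})^α)^{-r} = m2^{-r} ρ^{k-1}`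
    have hpow : (L ^ (k - 1)) ^ d * ((L ^ (k - 1)) ^ (2 * α - (d : ℝ)) * (m2 * (L ^ (k - 1)) ^ α) ^ (-r)) =
        m2 ^ (-r) * ρ ^ (k - 1) := by
      have hu : ((L ^ (k - 1) : ℝ)) ^ (d : ℕ) = (L ^ (k - 1)) ^ (d : ℝ) := (Real.rpow_natCast _ d).symm
      rw [hu, Real.mul_rpow hm2.le (Real.rpow_nonneg hℓk0.le _), ← Real.rpow_mul hℓk0.le]
      have hρk : ρ ^ (k - 1) = (L ^ (k - 1)) ^ (α * (2 - r)) := by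
        rw [hρ, ← Real.rpow_natCast (L ^ (α * (2 - r))) (k - 1), ← Real.rpow_mul hL0.le,
          ← Real.rpow_natCast L (k - 1), ← Real.rpow_mul hL0.le]
        congr 1
        ring
      rw [hρk]
      have e : ∀ a b c' : ℝ, (L ^ (k - 1)) ^ a * ((L ^ (k - 1)) ^ b * (m2 ^ (-r) * (L ^ (k - 1)) ^ c')) =
          m2 ^ (-r) * ((L ^ (k - 1)) ^ a * (L ^ (k - 1)) ^ b * (L ^ (k - 1)) ^ c') := fun a b c' => by ring
      rw [e, ← Real.rpow_add hℓk0, ← Real.rpow_add hℓk0]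
      congr 2
      ring
    calc ∑ x ∈ S, |DC k x| = ∑ x ∈ S ∩ ball (L ^ k / 2), |DC k x| := hrestr
      _ ≤ ∑ _x ∈ S ∩ ball (L ^ k / 2), cD * (L ^ (k - 1)) ^ (2 * α - d) * (m2 * (L ^ (k - 1)) ^ α) ^ (-r) :=
          Finset.sum_le_sum fun x _ => hsupD k hk hkj x
      _ = ((S ∩ ball (L ^ k / 2)).card : ℝ) *
            (cD * (L ^ (k - 1)) ^ (2 * α - d) * (m2 * (L ^ (k - 1)) ^ α) ^ (-r)) := by
          rw [Finset.sum_const, nsmul_eq_mul]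
      _ ≤ 2 ^ d * L ^ d * (L ^ (k - 1)) ^ d *
            (cD * (L ^ (k - 1)) ^ (2 * α - d) * (m2 * (L ^ (k - 1)) ^ α) ^ (-r)) :=
          mul_le_mul_of_nonneg_right hcard (by positivity)
      _ = 2 ^ d * L ^ d * cD * ((L ^ (k - 1)) ^ d *
            ((L ^ (k - 1)) ^ (2 * α - (d : ℝ)) * (m2 * (L ^ (k - 1)) ^ α) ^ (-r))) := by ring
      _ = 2 ^ d * L ^ d * cD * m2 ^ (-r) * ρ ^ (k - 1) := by rw [hpow]; ring
  -- `‖∂w_i‖₁ ≤ 2^d L^d c_D m^{-2r} K_ρ ρ^j` for `i ≤ j+1`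
  have hl1DW : ∀ i, i ≤ j + 1 → ∑ x ∈ S, |DW i x| ≤ 2 ^ d * L ^ d * cD * m2 ^ (-r) * (Kρ * ρ ^ j) := by
    intro i hi
    calc ∑ x ∈ S, |DW i x| ≤ ∑ x ∈ S, ∑ k ∈ Finset.Icc 1 i, |DC k x| :=
          Finset.sum_le_sum fun x _ => Finset.abs_sum_le_sum_abs _ _
      _ = ∑ k ∈ Finset.Icc 1 i, ∑ x ∈ S, |DC k x| := Finset.sum_comm
      _ ≤ ∑ k ∈ Finset.Icc 1 i, 2 ^ d * L ^ d * cD * m2 ^ (-r) * ρ ^ (k - 1) :=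
          Finset.sum_le_sum fun k hk => hl1D k (Finset.mem_Icc.1 hk).1 ((Finset.mem_Icc.1 hk).2.trans hi)
      _ = 2 ^ d * L ^ d * cD * m2 ^ (-r) * ∑ k ∈ Finset.Icc 1 i, ρ ^ (k - 1) := by rw [Finset.mul_sum]
      _ ≤ 2 ^ d * L ^ d * cD * m2 ^ (-r) * ∑ k ∈ Finset.range (j + 1), ρ ^ k := by
          gcongr
          -- reindex `k ↦ k - 1` : `Icc 1 i → range (j+1)`
          calc ∑ k ∈ Finset.Icc 1 i, ρ ^ (k - 1) = ∑ k ∈ Finset.range i, ρ ^ k := by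
                have e : Finset.Icc 1 i = Finset.Ico (0 + 1) (i + 1) := by
                  ext k
                  simp only [Finset.mem_Icc, Finset.mem_Ico]
                  omega
                rw [e, ← Finset.sum_Ico_add', ← Finset.range_eq_Ico]
                exact Finset.sum_congr rfl fun k _ => by rw [Nat.add_sub_cancel]
            _ ≤ ∑ k ∈ Finset.range (j + 1), ρ ^ k :=
                Finset.sum_le_sum_of_subset_of_nonneg (Finset.range_mono (by omega))
                  fun k _ _ => by positivity
      _ ≤ 2 ^ d * L ^ d * cD * m2 ^ (-r) * (ρ ^ j * (ρ / (ρ - 1))) := by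
          gcongr
          exact geom_sum_range_le hρ1 j
      _ = 2 ^ d * L ^ d * cD * m2 ^ (-r) * (Kρ * ρ ^ j) := by rw [hKρ]; ring
  -- the `ℓ¹` bounds on `w_j`, `w_{j+1}`
  have hl1W : ∀ i, i ≤ j + 1 → ∑ x ∈ S, |wCov d L α m2 i x| ≤ c₁ * L ^ d * (L ^ α * (L ^ α) ^ j) := by
    intro i hi
    refine (hW L hL m2 hm2.le hm21 i S).trans ?_
    have h1 : 1 ≤ L ^ α := Real.one_le_rpow hL1 hα0.le
    have : (L ^ α) ^ scaleMin L α m2 i ≤ (L ^ α) ^ (j + 1) :=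
      pow_le_pow_right₀ h1 ((scaleMin_le L α m2 i).trans hi)
    rw [pow_succ'] at this
    exact mul_le_mul_of_nonneg_left this (by positivity)
  -- the derivative of `β'_j`
  set D : ℝ := (n + 8) * ∑ x ∈ S, (DC (j + 1) x * (wCov d L α m2 j x + wCov d L α m2 (j + 1) x) +
      fracCov d L α m2 (j + 1) x * (DW j x + DW (j + 1) x)) with hDdef
  have hβ'fun : (fun a : ℝ => betaPrime d n L α a j) =
      fun a => (n + 8) * ∑ x ∈ S, (wCov d L α a (j + 1) x ^ 2 - wCov d L α a j x ^ 2) := by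
    funext a
    unfold betaPrime
    rw [powSum_eq_sum (S := S) (fun x hx => wCov_eq_zero_of_not_mem_ball hd hL1 α a le_rfl hx) two_ne_zero,
      powSum_eq_sum (S := S) (fun x hx => wCov_eq_zero_of_not_mem_ball hd hL1 α a (Nat.le_succ j) hx)
        two_ne_zero, ← Finset.sum_sub_distrib]
  have hDC1 : ∀ x, HasDerivAt (fun a : ℝ => fracCov d L α a (j + 1) x) (DC (j + 1) x) m2 := fun x =>
    (hasDerivAt_fracCov_mass hd hα0 hα2 hL hm2 (by omega) x).2.differentiableAt.hasDerivAt
  have hDWsucc : ∀ x, DW (j + 1) x = DW j x + DC (j + 1) x := by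
    intro x
    simp only [hDW]
    rw [Finset.sum_Icc_succ_top (by omega)]
  have hβ' : HasDerivAt (fun a : ℝ => betaPrime d n L α a j) D m2 := by
    rw [hβ'fun]
    have h := HasDerivAt.const_mul ((n : ℝ) + 8) (HasDerivAt.fun_sum (u := S)
      fun x _ => ((hW' (j + 1) x).pow 2).sub ((hW' j x).pow 2))
    refine h.congr_deriv ?_
    rw [hDdef]
    congr 1
    refine Finset.sum_congr rfl fun x _ => ?_
    rw [hDWsucc x, wCov_succ]
    push_cast
    ring
  -- |D| ≤ (n+8)(Term A + Term B)
  have hDabs : |D| ≤ c * ℓ ^ (3 * α - (d : ℝ)) * Aj ^ (-r) := by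
    -- Term A
    have hA' : ∑ x ∈ S, |DC (j + 1) x| * (|wCov d L α m2 j x| + |wCov d L α m2 (j + 1) x|) ≤
        cD * ℓ ^ (2 * α - (d : ℝ)) * Aj ^ (-r) * (2 * (c₁ * L ^ d * (L ^ α * (L ^ α) ^ j))) := by
      have hsup : ∀ x, |DC (j + 1) x| ≤ cD * ℓ ^ (2 * α - (d : ℝ)) * Aj ^ (-r) := by
        intro x
        have h := hsupD (j + 1) (by omega) le_rfl x
        rw [Nat.add_sub_cancel] at h
        exact h
      calc ∑ x ∈ S, |DC (j + 1) x| * (|wCov d L α m2 j x| + |wCov d L α m2 (j + 1) x|)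
          ≤ ∑ x ∈ S, cD * ℓ ^ (2 * α - (d : ℝ)) * Aj ^ (-r) * (|wCov d L α m2 j x| + |wCov d L α m2 (j + 1) x|) :=
            Finset.sum_le_sum fun x _ => mul_le_mul_of_nonneg_right (hsup x) (by positivity)
        _ = cD * ℓ ^ (2 * α - (d : ℝ)) * Aj ^ (-r) *
              (∑ x ∈ S, |wCov d L α m2 j x| + ∑ x ∈ S, |wCov d L α m2 (j + 1) x|) := by
            rw [← Finset.sum_add_distrib, Finset.mul_sum]
        _ ≤ cD * ℓ ^ (2 * α - (d : ℝ)) * Aj ^ (-r) * (c₁ * L ^ d * (L ^ α * (L ^ α) ^ j) +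
              c₁ * L ^ d * (L ^ α * (L ^ α) ^ j)) :=
            mul_le_mul_of_nonneg_left (add_le_add (hl1W j (Nat.le_succ j)) (hl1W (j + 1) le_rfl))
              (by positivity)
        _ = cD * ℓ ^ (2 * α - (d : ℝ)) * Aj ^ (-r) * (2 * (c₁ * L ^ d * (L ^ α * (L ^ α) ^ j))) := by ring
    -- Term B
    have hB' : ∑ x ∈ S, |fracCov d L α m2 (j + 1) x| * (|DW j x| + |DW (j + 1) x|) ≤
        c₀ * ℓ ^ (α - (d : ℝ)) * (2 * (2 ^ d * L ^ d * cD * m2 ^ (-r) * (Kρ * ρ ^ j))) := by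
      calc ∑ x ∈ S, |fracCov d L α m2 (j + 1) x| * (|DW j x| + |DW (j + 1) x|)
          ≤ ∑ x ∈ S, c₀ * ℓ ^ (α - (d : ℝ)) * (|DW j x| + |DW (j + 1) x|) :=
            Finset.sum_le_sum fun x _ => mul_le_mul_of_nonneg_right (hsupC x) (by positivity)
        _ = c₀ * ℓ ^ (α - (d : ℝ)) * (∑ x ∈ S, |DW j x| + ∑ x ∈ S, |DW (j + 1) x|) := by
            rw [← Finset.sum_add_distrib, Finset.mul_sum]
        _ ≤ c₀ * ℓ ^ (α - (d : ℝ)) * (2 ^ d * L ^ d * cD * m2 ^ (-r) * (Kρ * ρ ^ j) +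
              2 ^ d * L ^ d * cD * m2 ^ (-r) * (Kρ * ρ ^ j)) :=
            mul_le_mul_of_nonneg_left (add_le_add (hl1DW j (Nat.le_succ j)) (hl1DW (j + 1) le_rfl))
              (by positivity)
        _ = c₀ * ℓ ^ (α - (d : ℝ)) * (2 * (2 ^ d * L ^ d * cD * m2 ^ (-r) * (Kρ * ρ ^ j))) := by ring
    -- power identities
    have hpA : ℓ ^ (2 * α - (d : ℝ)) * (L ^ α) ^ j = ℓ ^ (3 * α - (d : ℝ)) := by
      rw [hℓ, ← pow_rpow_comm hL0.le, ← Real.rpow_add hℓ0]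
      congr 1
      ring
    have hpB : ℓ ^ (α - (d : ℝ)) * (m2 ^ (-r) * ρ ^ j) = ℓ ^ (3 * α - (d : ℝ)) * Aj ^ (-r) := by
      rw [hAjdef, Real.mul_rpow hm2.le (Real.rpow_nonneg hℓ0.le _), hρ, hℓ, ← pow_rpow_comm hL0.le,
        ← Real.rpow_mul (by positivity : (0 : ℝ) ≤ L ^ j)]
      have e : (L ^ j) ^ (α - (d : ℝ)) * (m2 ^ (-r) * (L ^ j) ^ (α * (2 - r))) =
          m2 ^ (-r) * ((L ^ j) ^ (α - (d : ℝ)) * (L ^ j) ^ (α * (2 - r))) := by ring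
      have e' : (L ^ j) ^ (3 * α - (d : ℝ)) * (m2 ^ (-r) * (L ^ j) ^ (α * -r)) =
          m2 ^ (-r) * ((L ^ j) ^ (3 * α - (d : ℝ)) * (L ^ j) ^ (α * -r)) := by ring
      rw [e, e', ← Real.rpow_add hℓ0, ← Real.rpow_add hℓ0]
      congr 2
      ring
    have h2n : (0 : ℝ) ≤ (n : ℝ) + 8 := by positivity
    rw [hDdef, abs_mul, abs_of_nonneg h2n]
    calc ((n : ℝ) + 8) * |∑ x ∈ S, (DC (j + 1) x * (wCov d L α m2 j x + wCov d L α m2 (j + 1) x) +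
          fracCov d L α m2 (j + 1) x * (DW j x + DW (j + 1) x))|
        ≤ ((n : ℝ) + 8) * (∑ x ∈ S, |DC (j + 1) x| * (|wCov d L α m2 j x| + |wCov d L α m2 (j + 1) x|) +
            ∑ x ∈ S, |fracCov d L α m2 (j + 1) x| * (|DW j x| + |DW (j + 1) x|)) := by
          refine mul_le_mul_of_nonneg_left ((Finset.abs_sum_le_sum_abs _ _).trans ?_) h2n
          rw [← Finset.sum_add_distrib]
          refine Finset.sum_le_sum fun x _ => (abs_add_le _ _).trans (add_le_add ?_ ?_)
          · rw [abs_mul]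
            exact mul_le_mul_of_nonneg_left (abs_add_le _ _) (abs_nonneg _)
          · rw [abs_mul]
            exact mul_le_mul_of_nonneg_left (abs_add_le _ _) (abs_nonneg _)
      _ ≤ ((n : ℝ) + 8) * (cD * ℓ ^ (2 * α - (d : ℝ)) * Aj ^ (-r) * (2 * (c₁ * L ^ d * (L ^ α * (L ^ α) ^ j))) +
            c₀ * ℓ ^ (α - (d : ℝ)) * (2 * (2 ^ d * L ^ d * cD * m2 ^ (-r) * (Kρ * ρ ^ j)))) :=
          mul_le_mul_of_nonneg_left (add_le_add hA' hB') h2n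
      _ = ((n : ℝ) + 8) * (2 * c₁ * cD * (L ^ d * L ^ α) * (ℓ ^ (2 * α - (d : ℝ)) * (L ^ α) ^ j) * Aj ^ (-r) +
            2 * (c₀ * (2 ^ d * L ^ d * cD * Kρ)) * (ℓ ^ (α - (d : ℝ)) * (m2 ^ (-r) * ρ ^ j))) := by ring
      _ = c * ℓ ^ (3 * α - (d : ℝ)) * Aj ^ (-r) := by rw [hpA, hpB, hc]; ring
  -- from `β'_j` to `β_j`: the rescaling is locally constant near `m²`
  set T : ℝ := L ^ (-(α * ((j : ℝ) - 1))) with hT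
  have hm2T : m2 < T := by
    have h1 : m2 ≤ (ℓ ^ α)⁻¹ := by
      rw [le_inv_comm₀ hm2 (by positivity)]
      calc ℓ ^ α = m2⁻¹ * (m2 * ℓ ^ α) := by field_simp
        _ ≤ m2⁻¹ * 1 := by gcongr
        _ = m2⁻¹ := mul_one _
    refine lt_of_le_of_lt h1 ?_
    rw [hT, hℓ, ← Real.rpow_natCast L j, ← Real.rpow_mul hL0.le, ← Real.rpow_neg hL0.le]
    exact Real.rpow_lt_rpow_of_exponent_lt hL1' (by nlinarith)
  have hloc : (fun a : ℝ => betaCoeff d n L α a j) =ᶠ[𝓝 m2]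
      fun a => ((L ^ (2 * α - d)) ^ j)⁻¹ * betaPrime d n L α a j := by
    filter_upwards [Iio_mem_nhds hm2T] with a ha
    rw [betaCoeff, (scaleMin_eq_of_lt hL1' hα0 ha).1]
  have hβ : HasDerivAt (fun a : ℝ => betaCoeff d n L α a j) (((L ^ (2 * α - d)) ^ j)⁻¹ * D) m2 :=
    (hβ'.const_mul _).congr_of_eventuallyEq hloc
  refine ⟨hβ.differentiableAt.hasDerivAt, ?_⟩
  rw [hβ.deriv, abs_mul, abs_inv, abs_of_pos (by positivity : (0 : ℝ) < (L ^ (2 * α - d)) ^ j)]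
  have hP0 : 0 < (L ^ (2 * α - (d : ℝ))) ^ j := by positivity
  rw [inv_mul_le_iff₀ hP0]
  refine hDabs.trans (le_of_eq ?_)
  -- `c ℓ^{3α-d} A_j^{-r} = (L^{2α-d})^j (c (L^α)^j A_j^{-r})`
  have : ℓ ^ (3 * α - (d : ℝ)) = (L ^ (2 * α - (d : ℝ))) ^ j * (L ^ α) ^ j := by
    rw [hℓ, pow_rpow_comm hL0.le, rpow_pow_mul_rpow_pow hL0]
    congr 1
    congr 1
    ring
  rw [this, hAjdef, hℓ]
  ring

/-- **Lemma 5.2.1, (5.23), `d = 1`** (for the explicit decomposition; `α ∈ (½,1)`, `n ≥ 0`, fixed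
`L ≥ 2`): there is `c_{∂β}` (depending on `L`) with `|∂β_j/∂m²| ≤ c_{∂β}L^{αj}(m²L^{αj})^{-r}`,
`r = 2 - 1/α`, for all `m² > 0` with `m²L^{αj} ≤ 1` (hence `j + 1 ≤ j_m`) and all `j ≥ 0`; the
derivative exists. Printed: "with `c_{∂β}` dependent on `L`, and assuming `m² ∈ (0,m̄²]`, and
`j ≤ j_m`, (5.23) `|∂β_j/∂m²| ≤ c_{∂β}L^{αj}(1+𝟙_{d=2}|log(m²L^{αj})|)/(m²L^{αj})^r` with `r = 2-1/α`
(`d = 1`), `2-2/α` (`d = 2,3`)" — here on the range `m²L^{αj} ≤ 1` of its proof ("we restrict to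
`m²L^{αj} ∈ (0,1]`"). [cite: Slade2017, Lemma 5.2.1 (display (5.23), d = 1)] [cite: Slade2017, §10.2 (proof of (5.23))] -/
theorem Slade2017_lem521_massDeriv_d1 (n : ℕ) {α : ℝ} (hα0 : 1 / 2 < α) (hα1 : α < 1) {L : ℝ}
    (hL : 2 ≤ L) :
    ∃ c : ℝ, 0 < c ∧ ∀ m2 : ℝ, 0 < m2 → ∀ j : ℕ, m2 * (L ^ j) ^ α ≤ 1 →
      HasDerivAt (fun a : ℝ => betaCoeff 1 n L α a j) (deriv (fun a : ℝ => betaCoeff 1 n L α a j) m2) m2 ∧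
      |deriv (fun a : ℝ => betaCoeff 1 n L α a j) m2| ≤
        c * (L ^ α) ^ j * (m2 * (L ^ j) ^ α) ^ (-(2 - 1 / α)) := by
  obtain ⟨cD, hcD, h⟩ := FRD.Slade2017_prop331_massDeriv_d1 hα0 hα1
  have hα : (0 : ℝ) < α := by linarith
  have hr2 : 2 - 1 / α < 2 := by
    have : 0 < 1 / α := by positivity
    linarith
  refine abs_deriv_betaCoeff_le_of (d := 1) le_rfl n hα (by linarith) (by exact_mod_cast hα1) hcD hr2
    (fun L hL m2 hm2 j hj x hA => ?_) hL
  have := (h L hL m2 hm2 j hj x hA).2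
  push_cast at this ⊢
  exact this

/-- **Lemma 5.2.1, (5.23), `d = 2`** (explicit decomposition; `α ∈ (1,2)`, fixed `L ≥ 2`), with the
logarithm absorbed into an arbitrarily small power `θ ∈ (0,1]` exactly as the paper does when it
uses (5.23) ("To deal with the logarithmic factor in (5.23) for `d = 2`, we increase `r` slightly to
absorb it", proof of Lemma 5.2.4): `|∂β_j/∂m²| ≤ cL^{αj}(m²L^{αj})^{-(2-2/α+2θ/α)}` for `m² > 0`,
`m²L^{αj} ≤ 1`, all `j`. [cite: Slade2017, Lemma 5.2.1 (display (5.23), d = 2); Lemma 5.2.4 (proof)] [cite: Slade2017, §10.2 (proof of (5.23))] -/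
theorem Slade2017_lem521_massDeriv_d2 (n : ℕ) {α : ℝ} (hα1 : 1 < α) (hα2 : α < 2) {θ : ℝ}
    (hθ0 : 0 < θ) (hθ1 : θ ≤ 1) (hθα : θ < 1) {L : ℝ} (hL : 2 ≤ L) :
    ∃ c : ℝ, 0 < c ∧ ∀ m2 : ℝ, 0 < m2 → ∀ j : ℕ, m2 * (L ^ j) ^ α ≤ 1 →
      HasDerivAt (fun a : ℝ => betaCoeff 2 n L α a j) (deriv (fun a : ℝ => betaCoeff 2 n L α a j) m2) m2 ∧
      |deriv (fun a : ℝ => betaCoeff 2 n L α a j) m2| ≤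
        c * (L ^ α) ^ j * (m2 * (L ^ j) ^ α) ^ (-(2 - 2 / α + 2 * θ / α)) := by
  obtain ⟨cD, hcD, h⟩ := FRD.Slade2017_prop331_massDeriv_d2 hα1 hα2 hθ0 hθ1
  have hα : (0 : ℝ) < α := by linarith
  have hr2 : 2 - 2 / α + 2 * θ / α < 2 := by
    rw [show 2 - 2 / α + 2 * θ / α = 2 - 2 * (1 - θ) / α by ring]
    have : 0 < 2 * (1 - θ) / α := by
      apply div_pos _ hα
      linarith
    linarith
  refine abs_deriv_betaCoeff_le_of (d := 2) (by norm_num) n hα hα2 (by exact_mod_cast hα2) hcD hr2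
    (fun L hL m2 hm2 j hj x hA => ?_) hL
  have := (h L hL m2 hm2 j hj x hA).2
  push_cast at this ⊢
  exact this

/-- **Lemma 5.2.1, (5.23), `d = 3`** (indeed every `d ≥ 3`; explicit decomposition; `α ∈ (1,2)`,
`α < d`, fixed `L ≥ 2`): `|∂β_j/∂m²| ≤ cL^{αj}(m²L^{αj})^{-(2-2/α)}` for `m² > 0`, `m²L^{αj} ≤ 1`, all
`j`; the derivative exists. [cite: Slade2017, Lemma 5.2.1 (display (5.23), d = 3)] [cite: Slade2017, §10.2 (proof of (5.23))] -/
theorem Slade2017_lem521_massDeriv_dge3 (hd : 3 ≤ d) (n : ℕ) {α : ℝ} (hα1 : 1 < α) (hα2 : α < 2)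
    {L : ℝ} (hL : 2 ≤ L) :
    ∃ c : ℝ, 0 < c ∧ ∀ m2 : ℝ, 0 < m2 → ∀ j : ℕ, m2 * (L ^ j) ^ α ≤ 1 →
      HasDerivAt (fun a : ℝ => betaCoeff d n L α a j) (deriv (fun a : ℝ => betaCoeff d n L α a j) m2) m2 ∧
      |deriv (fun a : ℝ => betaCoeff d n L α a j) m2| ≤
        c * (L ^ α) ^ j * (m2 * (L ^ j) ^ α) ^ (-(2 - 2 / α)) := by
  obtain ⟨cD, hcD, h⟩ := FRD.Slade2017_prop331_massDeriv_dge3 hd hα1 hα2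
  have hα : (0 : ℝ) < α := by linarith
  have hr2 : 2 - 2 / α < 2 := by
    have : 0 < 2 / α := by positivity
    linarith
  have hαd : α < d := by
    have : (3 : ℝ) ≤ d := by exact_mod_cast hd
    linarith
  exact abs_deriv_betaCoeff_le_of (by omega) n hα hα2 hαd hcD hr2
    (fun L hL m2 hm2 j hj x hA => (h L hL m2 hm2 j hj x hA).2) hL

end PT

end LongRangePhi4

end Literature.Barriers.CriticalPhenomena
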